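import Summits.Ventures.GridStability.Models.InverterMatchingDQ

/-!
# GridStability/Models/InverterMatchingDQRate — matching control (dq-frame): the EXPLICIT decay rate under condition (11)/(17) as a typed constant, and componentwise convergence `x(t) → x*`

Cell `gridfusion` (rung G3; seat gridfusion-model-3 (g8)). Typed answers to ref-3's precisions W3/W4 on #100-cand
«G3.c-MATCHING-GFM-GLOBAL-THM» (LEDGER-3 row 64): in `Models/InverterMatchingDQ.lean` (p538141) the rate of
`exists_rate_of_cond` is existential in the statement (explicit only in the proof) and `x(t) → x*` componentwise is a
hand corollary of `V₁ → 0`. Here both are TYPED: `condRate` is the closed-form rate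
`ρ* = min((G_dc − m/t*)/C_dc, (1 − t*) R/L, (1 − t*) G/C)`, `t* = (m + G_dc)/(2 G_dc)`, with `condRate_pos` and
`two_mul_condRate_mul_storage_le` under (11)/(17); `storage_le_mul_exp_of_cond` is the decay with that rate; and
`tendsto_state_of_cond` gives `x_k(t) → x*_k` for every component along every solution on `[0, ∞)`.
Source: [cite: ArghirJouiniDorfler2018, Thm. 3, Cor. 4] (arXiv:1706.09495 p0005–p0006). THREE COLUMNS as in the parent
file: statements about MODEL M_match-dq under (11)/(17); nothing says a converter is stable.
-/

noncomputable section

open Real Set Filter Finset Topology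

namespace Summit.Ventures.GridStability.Models.MatchingDQ

variable (K : MatchingDQ)

/-- The interpolation parameter `t* = (m + G_dc)/(2 G_dc)` of the rate construction. -/
def condParam (xs : State) : ℝ := (K.margin xs + K.Gdc) / (2 * K.Gdc)

/-- The EXPLICIT rate under (11)/(17): `ρ* = min((G_dc − m/t*)/C_dc, (1 − t*) R/L, (1 − t*) G/C)`.
[cite: ArghirJouiniDorfler2018, Thm. 3 / Cor. 4 (positive definiteness of `Q`)] -/
def condRate (xs : State) : ℝ :=
  min ((K.Gdc - K.margin xs / K.condParam xs) / K.Cdc)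
    (min ((1 - K.condParam xs) * K.R / K.L) ((1 - K.condParam xs) * K.G / K.C))

/-- `ρ* > 0` under `C_dc, L, C, R, G > 0` and `m < G_dc`. -/
theorem condRate_pos (hC : 0 < K.Cdc) (hL : 0 < K.L) (hC' : 0 < K.C) (hR : 0 < K.R) (hG : 0 < K.G)
    {xs : State} (hcond : K.margin xs < K.Gdc) : 0 < K.condRate xs := by
  have hm0 : 0 ≤ K.margin xs := by unfold margin; positivity
  have hg : 0 < K.Gdc := hm0.trans_lt hcond
  have ht : 0 < K.condParam xs := by unfold condParam; positivity
  have ht1 : K.condParam xs < 1 := by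
    unfold condParam; rw [div_lt_one (by positivity)]; linarith
  have ha : 0 < K.Gdc - K.margin xs / K.condParam xs := by
    have : K.margin xs / K.condParam xs < K.Gdc := by
      rw [div_lt_iff₀ ht]; unfold condParam; field_simp; nlinarith
    linarith
  have h1t := sub_pos.2 ht1
  unfold condRate
  exact lt_min (div_pos ha hC) (lt_min (by positivity) (by positivity))

/-- `2 ρ* V₁(x̃) ≤ x̃ᵀQx̃` at every state, under `C_dc, L, C, R, G > 0` and `m < G_dc`. -/
theorem two_mul_condRate_mul_storage_le (hC : 0 < K.Cdc) (hL : 0 < K.L) (hC' : 0 < K.C) (hR : 0 < K.R)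
    (hG : 0 < K.G) {xs : State} (hcond : K.margin xs < K.Gdc) (x : State) :
    2 * K.condRate xs * K.storage xs x ≤ K.dissipation xs x := by
  have hm0 : 0 ≤ K.margin xs := by unfold margin; positivity
  have hg : 0 < K.Gdc := hm0.trans_lt hcond
  have ht : 0 < K.condParam xs := by unfold condParam; positivity
  set ρ := K.condRate xs
  have hρa : ρ ≤ (K.Gdc - K.margin xs / K.condParam xs) / K.Cdc := min_le_left _ _
  have hρb : ρ ≤ (1 - K.condParam xs) * K.R / K.L := (min_le_right _ _).trans (min_le_left _ _)
  have hρc : ρ ≤ (1 - K.condParam xs) * K.G / K.C := (min_le_right _ _).trans (min_le_right _ _)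
  have hlow := K.dissipation_ge hR hG xs x ht
  have hst : 2 * ρ * K.storage xs x = ρ * K.Cdc * (x 0 - xs 0) ^ 2
      + ρ * K.L * ((x 1 - xs 1) ^ 2 + (x 2 - xs 2) ^ 2) + ρ * K.C * ((x 3 - xs 3) ^ 2 + (x 4 - xs 4) ^ 2) := by
    simp only [storage, Fin.sum_univ_five, coef, Matrix.cons_val_zero, Matrix.cons_val_one, Matrix.cons_val]
    ring
  have e1 : ρ * K.Cdc ≤ K.Gdc - K.margin xs / K.condParam xs := by rwa [le_div_iff₀ hC] at hρa
  have e2 : ρ * K.L ≤ (1 - K.condParam xs) * K.R := by rwa [le_div_iff₀ hL] at hρb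
  have e3 : ρ * K.C ≤ (1 - K.condParam xs) * K.G := by rwa [le_div_iff₀ hC'] at hρc
  rw [hst]
  nlinarith [sq_nonneg (x 0 - xs 0), sq_nonneg (x 1 - xs 1), sq_nonneg (x 2 - xs 2), sq_nonneg (x 3 - xs 3),
    sq_nonneg (x 4 - xs 4), hR, hG]

variable {K}

/-- **Decay with the EXPLICIT rate (typed W3).** Under `C_dc, L, C, R, G > 0`, equilibrium `x*` with `m < G_dc`:
along every solution on `[0, T]`, `V₁(x(t) − x*) ≤ V₁(x(0) − x*) e^{−2ρ* t}`. [cite: ArghirJouiniDorfler2018, Cor. 4] -/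
theorem storage_le_mul_exp_of_cond (hC : 0 < K.Cdc) (hL : 0 < K.L) (hC' : 0 < K.C) (hR : 0 < K.R)
    (hG : 0 < K.G) {xs : State} (hxs : K.IsEquilibrium xs) (hcond : K.margin xs < K.Gdc)
    {T : ℝ} {γ : ℝ → State} (h : K.IsSolutionOn γ (Icc 0 T)) {t : ℝ} (ht : t ∈ Icc 0 T) :
    K.storage xs (γ t) ≤ K.storage xs (γ 0) * exp (-(2 * K.condRate xs * t)) :=
  storage_le_mul_exp hC.ne' hL.ne' hC'.ne' hxs (K.two_mul_condRate_mul_storage_le hC hL hC' hR hG hcond) h ht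

/-- **Componentwise convergence `x_k(t) → x*_k` (typed W4).** Under the same hypotheses, along every solution on
`[0, ∞)` every state component converges to its steady-state value. [cite: ArghirJouiniDorfler2018, Cor. 4] -/
theorem tendsto_state_of_cond (hC : 0 < K.Cdc) (hL : 0 < K.L) (hC' : 0 < K.C) (hR : 0 < K.R) (hG : 0 < K.G)
    {xs : State} (hxs : K.IsEquilibrium xs) (hcond : K.margin xs < K.Gdc)
    {γ : ℝ → State} (h : K.IsSolutionOn γ (Ici 0)) (k : Fin 5) :
    Tendsto (fun t => γ t k) atTop (𝓝 (xs k)) := by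
  have hV := storage_tendsto_zero_of_cond hC hL hC' hR hG hxs hcond h
  have hcoef : ∀ j, 0 < K.coef j := by intro j; fin_cases j <;> simp [coef, hC, hL, hC']
  -- the single term is dominated by the sum: coef_k e_k² ≤ 2 V₁
  have hterm : ∀ x, K.coef k * (x k - xs k) ^ 2 ≤ 2 * K.storage xs x := by
    intro x
    unfold storage
    rw [mul_div_cancel₀ _ (two_ne_zero)]
    exact Finset.single_le_sum (f := fun j => K.coef j * (x j - xs j) ^ 2)
      (fun j _ => mul_nonneg (hcoef j).le (sq_nonneg _)) (mem_univ k)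
  have hsq : Tendsto (fun t => (γ t k - xs k) ^ 2) atTop (𝓝 0) := by
    refine squeeze_zero (fun t => sq_nonneg _) (fun t => ?_) ?_ (g := fun t => 2 / K.coef k * K.storage xs (γ t))
    · have := hterm (γ t)
      rw [div_mul_eq_mul_div, le_div_iff₀ (hcoef k)]
      linarith
    · simpa using hV.const_mul (2 / K.coef k)
  have habs : Tendsto (fun t => |γ t k - xs k|) atTop (𝓝 0) := by
    have := (continuous_sqrt.tendsto 0).comp hsq
    simpa [Function.comp_def, Real.sqrt_sq_eq_abs] using this
  have h0 := (tendsto_zero_iff_abs_tendsto_zero (fun t => γ t k - xs k)).2 habs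
  simpa using h0.add_const (xs k)

end Summit.Ventures.GridStability.Models.MatchingDQ

end
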